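import Literature.Probability.LatticeModels.KCGaugedSections
import Literature.Probability.LatticeModels.KCFamilyBounds
import Literature.Probability.LatticeModels.LatticeToContinuumCross
import Literature.Probability.LatticeModels.LatticeToContinuumHolomorphic
import Literature.Probability.LatticeModels.LatticeToContinuumPrimitive
import Literature.Probability.LatticeModels.LatticeToContinuumLimit
import Literature.Probability.LatticeModels.KCPrimitiveIncrement
import HarnessLib

/-!
# Families of spin-fermion data with background spins: gauged charts, bounds and limits

Topic `Literature/Probability/LatticeModels`. Chelkak–Hongler–Izyurov 2015, §3.3–3.5 for the
spinor observables `F_δ = F_{[Ω_δ,a;a_1,…,a_k]}` with `k ≥ 1` marked points besides the source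
(the two-point case `k = 1` is the one behind Theorems 1.5 (`k = 1`), 1.7 and Remark 2.18 of the
source). `KCFamilyBounds/Limits/PrimitiveLimit.lean` treat `k = 0` (no background spins, `B = ∅`)
with one plain and one quadrant-gauged chart. This file is the `k ≥ 1` framework, uniform in the
background set and in the position of the branch cuts thanks to the ROW GAUGES of
`KCGaugedSections.lean`:

* `KCSectionFamily` — Kadanoff–Ceva data along the mesh WITH a background set `B δ`; `obs`
  (the section `kcObs … (B δ) …`), the NORMALISED section `obsN N δ = (N δ)^{-1/2} obs δ` for a
  normalising function `N` (`N ≡ 1` for Thm 2.16 itself; `N δ = M_δ(ε) → ∞` for the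
  renormalised functions of the boundedness argument, CHI §3.4), and the gauged normalised sections
  `gobsN N σ δ = (N δ)^{-1/2} (σ δ • obs δ)` for a field of row signs `σ`;
* `IsNiceCore Ω A N` — the standing hypotheses off a closed exceptional set `A` (admissible graph,
  cuts and primitive eventually; core bulk geometry near compacts of `Ω ∖ A`; the bound
  `|Hw|, |Hb| ≤ M · N δ` on compacts of `Ω ∖ A`, an OUTPUT of CHI's boundary argument taken here as
  the defining clause of the structure); `IsGauge U σ` — a chart: an open `U` on whose compacts,
  eventually, the sign conditions of `KCBulkGauge (σ δ)` hold (the `σ δ`-gauged section has no seam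
  over `U`);
* the lattice hypotheses of the observable-independent continuum chain on every chart:
  **`latticeSupHyp`** (for `obsN`, norms being gauge-free), **`latticeLipHyp`**, `isSHolAt_near`,
  `latticeCrossHyp`, `cr` (for `gobsN`), whence `exists_sqrt_bound`, `exists_equicont_bound`,
  `exists_cross_bound`, **`exists_subseq_limit`** (precompactness of `δ^{-1/2} gobsN` on `U`) and
  **`differentiableOn_of_limit`** (limits are holomorphic on `U`);
* the primitive: `hwN_increment_near` (increments of `Hw/N` are `-κ Im(i^e gobsN²)`, the square
  being gauge-free) and **`tendsto_hwN_staircase`** (staircase increments of `Hw/N` converge to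
  `-κ Im ∫ g²` along a convergent subsequence of a chart).

Squares of the sections and the primitives do not see the gauge, so the limits of different charts
glue (`gobsN_sq`); this is done by the user. Everything is proved; no named fact.

## References

* D. Chelkak, C. Hongler, K. Izyurov, Ann. of Math. 181 (2015): Prop. 2.4, Prop. 3.6, Thm 3.12,
  §3.4–3.5 [ChelkakHonglerIzyurovAnnals2015].
* S. Smirnov, Ann. of Math. 172 (2010), Remark 3.7 and §5 [Smirnov2010].
-/

noncomputable section

namespace Literature.Probability.LatticeModels

open Filter _root_.Topology Metric Set Finset Complex SimpleGraph

/-- `IsSHolAt` is stable under multiplication by a real constant. [folklore] -/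
theorem isSHolAt_const_mul {F : MedialVertex → ℂ} {q : Site 2 × Fin 4} (t : ℝ) (h : IsSHolAt F q) :
    IsSHolAt (fun e => (t : ℂ) * F e) q := by
  unfold IsSHolAt at h ⊢
  rw [projLine_ofReal_mul_right, projLine_ofReal_mul_right, h]

/-- `kcSupConst (M t) = √t · kcSupConst M` for `t ≥ 0`. [folklore] -/
theorem kcSupConst_mul (M : ℝ) {t : ℝ} (ht : 0 ≤ t) : kcSupConst (M * t) = Real.sqrt t * kcSupConst M := by
  unfold kcSupConst
  rw [show 4 * (4 * Real.sqrt 2 * kcFluxConst * (M * t) * energyGradConst) =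
      t * (4 * (4 * Real.sqrt 2 * kcFluxConst * M * energyGradConst)) by ring, Real.sqrt_mul ht]
  ring

/-- **A family of Kadanoff–Ceva data along the mesh with background spins**: free volume, plaquette
set, cut system, primitive pair and background set at every mesh `δ`. [cite: ChelkakHonglerIzyurovAnnals2015, §3.3] -/
structure KCSectionFamily where
  /-- the free sites -/
  Λ : ℝ → Finset (Site 2)
  /-- the plaquettes carrying cuts -/
  P : ℝ → Set (Site 2)
  /-- the cut system -/
  cut : ℝ → Site 2 → Finset (Sym2 (Site 2))
  /-- the primitive on sites -/
  Hw : ℝ → Site 2 → ℝ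
  /-- the primitive on plaquettes -/
  Hb : ℝ → Site 2 → ℝ
  /-- the background spins -/
  B : ℝ → Finset (Site 2)

namespace KCSectionFamily

variable (𝓕 : KCSectionFamily) (Ω : Set ℂ)

/-- The spin fermion of the data at mesh `δ` (`+` boundary condition, background spins `B δ`). [cite: ChelkakHonglerIzyurovAnnals2015, Def. 2.1] -/
def obs (δ : ℝ) : MedialVertex → ℂ := kcObs (discreteDomainGraph Ω δ) (𝓕.Λ δ) 1 (𝓕.B δ) (𝓕.cut δ)

/-- The normalised section `(N δ)^{-1/2} F_δ`. [cite: ChelkakHonglerIzyurovAnnals2015, §3.4 (renormalisation by M_δ)] -/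
def obsN (N : ℝ → ℝ) (δ : ℝ) (e : MedialVertex) : ℂ := (((Real.sqrt (N δ))⁻¹ : ℝ) : ℂ) * 𝓕.obs Ω δ e

/-- The gauged normalised section `(N δ)^{-1/2} (σ δ • F_δ)`. [cite: ChelkakHonglerIzyurovAnnals2015, §3.2 and §3.4] -/
def gobsN (N : ℝ → ℝ) (σ : ℝ → ℤ → ℝ) (δ : ℝ) (e : MedialVertex) : ℂ :=
  (((Real.sqrt (N δ))⁻¹ : ℝ) : ℂ) * rowGauge (σ δ) (𝓕.obs Ω δ) e

/-- The normalised primitive on sites. [cite: ChelkakHonglerIzyurovAnnals2015, §3.4] -/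
def HwN (N : ℝ → ℝ) (δ : ℝ) (y : Site 2) : ℝ := 𝓕.Hw δ y / N δ

variable {𝓕 Ω}

/-- Norms of the gauged normalised section are those of the normalised section. [folklore] -/
theorem norm_gobsN {N : ℝ → ℝ} {σ : ℝ → ℤ → ℝ} (hσ : ∀ δ r, σ δ r = 1 ∨ σ δ r = -1) (δ : ℝ) (e : MedialVertex) :
    ‖𝓕.gobsN Ω N σ δ e‖ = ‖𝓕.obsN Ω N δ e‖ := by
  rw [gobsN, obsN, norm_mul, norm_mul, norm_rowGauge (hσ δ)]

/-- Squares of the gauged normalised section are those of the normalised section. [folklore] -/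
theorem gobsN_sq {N : ℝ → ℝ} {σ : ℝ → ℤ → ℝ} (hσ : ∀ δ r, σ δ r = 1 ∨ σ δ r = -1) (δ : ℝ) (e : MedialVertex) :
    𝓕.gobsN Ω N σ δ e ^ 2 = 𝓕.obsN Ω N δ e ^ 2 := by
  rw [gobsN, obsN, mul_pow, mul_pow, rowGauge_sq (hσ δ)]

/-- The square of the normalised section: `obsN² = obs²/N`. [folklore] -/
theorem obsN_sq {N : ℝ → ℝ} {δ : ℝ} (hN : 0 < N δ) (e : MedialVertex) :
    𝓕.obsN Ω N δ e ^ 2 = ((N δ)⁻¹ : ℝ) * 𝓕.obs Ω δ e ^ 2 := by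
  rw [obsN, mul_pow, ← Complex.ofReal_pow, inv_pow, Real.sq_sqrt hN.le]

variable (𝓕 Ω)

/-- **The standing hypotheses of a nice family off the exceptional set `A`**, with normalising
function `N`. [cite: ChelkakHonglerIzyurovAnnals2015, §3.3–3.4 and Thm 3.13] -/
structure IsNiceCore (A : Set ℂ) (N : ℝ → ℝ) : Prop where
  adj : ∀ᶠ δ in 𝓝[>] (0 : ℝ), ∀ v ∈ 𝓕.Λ δ, ∀ k : Fin 4, (discreteDomainGraph Ω δ).Adj v (v + cornerUnit k)
  cuts : ∀ᶠ δ in 𝓝[>] (0 : ℝ), IsKCCuts (discreteDomainGraph Ω δ) (𝓕.Λ δ) (𝓕.cut δ) (𝓕.P δ)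
  prim : ∀ᶠ δ in 𝓝[>] (0 : ℝ),
    IsKCPrimitive (discreteDomainGraph Ω δ) (𝓕.Λ δ) criticalBetaTwo (.fixed 1) (𝓕.B δ) (𝓕.cut δ) (𝓕.Hw δ) (𝓕.Hb δ) (𝓕.P δ)
  pos : ∀ᶠ δ in 𝓝[>] (0 : ℝ), 0 < N δ
  bulk : ∀ K ⊆ Ω \ A, IsCompact K → ∃ ρ > 0, ∀ᶠ δ in 𝓝[>] (0 : ℝ), ∀ x y : Site 2, meshPoint δ x ∈ K →
    dist (meshPoint δ y) (meshPoint δ x) ≤ ρ →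
      y ∈ 𝓕.Λ δ ∧ y ∉ 𝓕.B δ ∧ edgeBoundary (discreteDomainGraph Ω δ) {y} = Finset.univ.image (fun k : Fin 4 => cSrc (y, k)) ∧
      (∀ k : Fin 4, faceAt y k ∈ 𝓕.P δ) ∧
      (∀ j : Fin 4, s(y + cornerOff j, y + cornerOff j + cornerUnit j) ∈ edgesTouching (discreteDomainGraph Ω δ) (𝓕.Λ δ)) ∧
      Odd #(Finset.univ.filter fun j : Fin 4 => s(y + cornerOff j, y + cornerOff j + cornerUnit j) ∈ 𝓕.cut δ y)
  hbound : ∀ K ⊆ Ω \ A, IsCompact K → ∃ M > 0, ∀ᶠ δ in 𝓝[>] (0 : ℝ), ∀ y : Site 2, meshPoint δ y ∈ K →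
    |𝓕.Hw δ y| ≤ M * N δ ∧ |𝓕.Hb δ y| ≤ M * N δ

/-- **A chart**: an open set `U` off the exceptional set over whose compacts, eventually, the
`σ δ`-gauged section has no seam. [cite: ChelkakHonglerIzyurovAnnals2015, Prop. 2.4 and §3.2] -/
structure IsGauge (U : Set ℂ) (σ : ℝ → ℤ → ℝ) : Prop where
  pm : ∀ δ r, σ δ r = 1 ∨ σ δ r = -1
  sgn : ∀ K ⊆ U, IsCompact K → ∃ ρ > 0, ∀ᶠ δ in 𝓝[>] (0 : ℝ), ∀ x y : Site 2, meshPoint δ x ∈ K →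
    dist (meshPoint δ y) (meshPoint δ x) ≤ ρ →
      hLowSign (𝓕.B δ) (y + cornerUnit 2) * vLowSign (𝓕.B δ) (𝓕.cut δ) (y + cornerUnit 3) = σ δ (y 1 - 1) * σ δ (y 1) ∧
      vLowSign (𝓕.B δ) (𝓕.cut δ) (y + cornerUnit 3) * hLowSign (𝓕.B δ) y = σ δ (y 1 - 1) * σ δ (y 1)

variable {𝓕 Ω}
variable {A U : Set ℂ} {N : ℝ → ℝ} {σ : ℝ → ℤ → ℝ}

/-- **The gauged bulk hypotheses on a lattice ball of Euclidean size `≤ ρ`**, from the clauses at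
radius `ρ`. [cite: ChelkakHonglerIzyurovAnnals2015, §3.3] -/
theorem kcBulkGauge_of_clauses {δ : ℝ} (hδ : 0 ≤ δ) {x : Site 2} {R : ℤ} {ρ : ℝ} (hR : δ * (2 * R) ≤ ρ)
    (hbulk : ∀ y : Site 2, dist (meshPoint δ y) (meshPoint δ x) ≤ ρ →
      y ∈ 𝓕.Λ δ ∧ y ∉ 𝓕.B δ ∧ edgeBoundary (discreteDomainGraph Ω δ) {y} = Finset.univ.image (fun k : Fin 4 => cSrc (y, k)) ∧
      (∀ k : Fin 4, faceAt y k ∈ 𝓕.P δ) ∧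
      (∀ j : Fin 4, s(y + cornerOff j, y + cornerOff j + cornerUnit j) ∈ edgesTouching (discreteDomainGraph Ω δ) (𝓕.Λ δ)) ∧
      Odd #(Finset.univ.filter fun j : Fin 4 => s(y + cornerOff j, y + cornerOff j + cornerUnit j) ∈ 𝓕.cut δ y))
    (hsgn : ∀ y : Site 2, dist (meshPoint δ y) (meshPoint δ x) ≤ ρ →
      hLowSign (𝓕.B δ) (y + cornerUnit 2) * vLowSign (𝓕.B δ) (𝓕.cut δ) (y + cornerUnit 3) = σ δ (y 1 - 1) * σ δ (y 1) ∧
      vLowSign (𝓕.B δ) (𝓕.cut δ) (y + cornerUnit 3) * hLowSign (𝓕.B δ) y = σ δ (y 1 - 1) * σ δ (y 1)) :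
    KCBulkGauge (discreteDomainGraph Ω δ) (𝓕.Λ δ) (𝓕.B δ) (𝓕.cut δ) (𝓕.P δ) (σ δ) (latticeBall x R) := by
  have hin : ∀ y ∈ latticeBall x R, dist (meshPoint δ y) (meshPoint δ x) ≤ ρ := fun y hy =>
    (KCFamily.dist_meshPoint_le_of_mem_latticeBall hδ hy).trans hR
  exact ⟨⟨fun y hy => (hbulk y (hin y hy)).1, fun y hy => (hbulk y (hin y hy)).2.1, fun y hy => (hbulk y (hin y hy)).2.2.1,
    fun y hy => (hbulk y (hin y hy)).2.2.2.1, fun y hy => (hbulk y (hin y hy)).2.2.2.2.1, fun y hy => (hbulk y (hin y hy)).2.2.2.2.2⟩,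
    fun y hy => (hsgn y (hin y hy)).1, fun y hy => (hsgn y (hin y hy)).2⟩

/-- **The lattice sup hypothesis for the normalised section on a chart.** [cite: ChelkakHonglerIzyurovAnnals2015, Thm 3.12 (3.12)] -/
theorem IsNiceCore.latticeSupHyp (h : 𝓕.IsNiceCore Ω A N) (hg : 𝓕.IsGauge U σ) (hUo : IsOpen U) (hUA : U ⊆ Ω \ A)
    {K : Set ℂ} (hK : IsCompact K) (hKU : K ⊆ U) :
    ∃ ρ > 0, ∃ M > 0, LatticeSupHyp (𝓕.obsN Ω N) K ρ (kcSupConst M) := by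
  obtain ⟨r, hr, hrU⟩ := hK.exists_cthickening_subset_open hUo hKU
  set K₁ := cthickening r K with hK₁
  have hK₁c : IsCompact K₁ := hK.cthickening
  have hK₁A : K₁ ⊆ Ω \ A := hrU.trans hUA
  obtain ⟨ρb, hρb, hbulk⟩ := h.bulk K₁ hK₁A hK₁c
  obtain ⟨ρs, hρs, hsgn⟩ := hg.sgn K₁ hrU hK₁c
  obtain ⟨M, hM, hbound⟩ := h.hbound K₁ hK₁A hK₁c
  set ρ := min r (min ρb ρs) with hρ
  have hρ0 : 0 < ρ := by positivity
  have hρr : ρ ≤ r := min_le_left _ _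
  have hρb' : ρ ≤ ρb := (min_le_right _ _).trans (min_le_left _ _)
  have hρs' : ρ ≤ ρs := (min_le_right _ _).trans (min_le_right _ _)
  refine ⟨ρ / 2, by positivity, M, hM, ?_⟩
  have h3 : ∀ᶠ δ in 𝓝[>] (0 : ℝ), 0 < δ := self_mem_nhdsWithin
  filter_upwards [h.adj, h.cuts, h.prim, h.pos, hbulk, hsgn, hbound, h3] with δ hadj hcuts hprim hN hb hs hbd hδ0 x hx p hp hsize y hy i hi
  set c : Site 2 := ![x 0 - 2 * (4 * p : ℕ), x 1 - 2 * (4 * p : ℕ)] with hcdef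
  have hcx : boxCentre c (4 * p) = x := boxCentre_sub x (4 * p)
  have hxK₁ : meshPoint δ x ∈ K₁ := self_subset_cthickening K hx
  have hR : δ * (2 * ((2 * (2 * (4 * (p : ℕ))) + 3 : ℕ) : ℤ)) ≤ ρ := by
    push_cast
    nlinarith [hsize, hδ0.le]
  have hKb := kcBulkGauge_of_clauses (𝓕 := 𝓕) (Ω := Ω) (σ := σ) hδ0.le (x := x) (R := ((2 * (2 * (4 * p)) + 3 : ℕ) : ℤ)) hR
    (fun y hy => hb x y hxK₁ (hy.trans hρb')) (fun y hy => hs x y hxK₁ (hy.trans hρs'))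
  rw [← hcx] at hKb
  have hMN : 0 < M * N δ := mul_pos hM hN
  have hMw : ∀ y ∈ latticeBall (boxCentre c (4 * p)) (2 * (2 * (4 * p)) + 1), |𝓕.Hw δ y| ≤ M * N δ := by
    intro y hy
    rw [hcx] at hy
    have hd : dist (meshPoint δ y) (meshPoint δ x) ≤ ρ := by
      refine (KCFamily.dist_meshPoint_le_of_mem_latticeBall hδ0.le hy).trans (le_trans ?_ hR)
      gcongr; push_cast; linarith
    exact (hbd y (Metric.mem_cthickening_of_dist_le _ _ _ _ hx (hd.trans hρr))).1
  have hMb : ∀ y ∈ latticeBall (boxCentre c (4 * p)) (2 * (2 * (4 * p)) + 1), |𝓕.Hb δ y| ≤ M * N δ := by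
    intro y hy
    rw [hcx] at hy
    have hd : dist (meshPoint δ y) (meshPoint δ x) ≤ ρ := by
      refine (KCFamily.dist_meshPoint_le_of_mem_latticeBall hδ0.le hy).trans (le_trans ?_ hR)
      gcongr; push_cast; linarith
    exact (hbd y (Metric.mem_cthickening_of_dist_le _ _ _ _ hx (hd.trans hρr))).2
  have hyb : y ∈ latticeBall (boxCentre c (4 * p)) p := by rw [hcx]; exact hy
  have hKb' : KCBulkGauge (discreteDomainGraph Ω δ) (𝓕.Λ δ) (𝓕.B δ) (𝓕.cut δ) (𝓕.P δ) (σ δ)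
      (latticeBall (boxCentre c (4 * p)) (2 * (2 * (4 * p)) + 3)) := by
    convert hKb using 2
    push_cast; ring
  have key := norm_kcObs_le_of_gauge hprim hcuts hadj (discreteDomainGraph_le_zdGraph Ω δ) (hg.pm δ) hp hKb' hMN hMw hMb hyb hi
  -- normalise
  have hsq : 0 < Real.sqrt (N δ) := Real.sqrt_pos.2 hN
  rw [kcSupConst_mul M hN.le] at key
  rw [obsN, norm_mul, Complex.norm_real, Real.norm_eq_abs, abs_of_pos (inv_pos.2 hsq)]
  calc (Real.sqrt (N δ))⁻¹ * ‖𝓕.obs Ω δ (cSrc (y, i))‖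
      ≤ (Real.sqrt (N δ))⁻¹ * (Real.sqrt (N δ) * kcSupConst M / Real.sqrt p) :=
        mul_le_mul_of_nonneg_left key (inv_nonneg.2 hsq.le)
    _ = kcSupConst M / Real.sqrt p := by field_simp

/-- **The lattice Lipschitz hypothesis for the gauged normalised section on a chart.** [cite: ChelkakHonglerIzyurovAnnals2015, Thm 3.12 (3.13)] -/
theorem IsNiceCore.latticeLipHyp (h : 𝓕.IsNiceCore Ω A N) (hg : 𝓕.IsGauge U σ) (hUo : IsOpen U) (hUA : U ⊆ Ω \ A)
    {K : Set ℂ} (hK : IsCompact K) (hKU : K ⊆ U) :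
    ∃ ρ > 0, ∃ M > 0, LatticeLipHyp (𝓕.gobsN Ω N σ) K ρ (8 * topGradConst * kcSupConst M) := by
  obtain ⟨r, hr, hrU⟩ := hK.exists_cthickening_subset_open hUo hKU
  set K₁ := cthickening r K with hK₁
  have hK₁c : IsCompact K₁ := hK.cthickening
  have hK₁A : K₁ ⊆ Ω \ A := hrU.trans hUA
  obtain ⟨ρb, hρb, hbulk⟩ := h.bulk K₁ hK₁A hK₁c
  obtain ⟨ρs, hρs, hsgn⟩ := hg.sgn K₁ hrU hK₁c
  obtain ⟨M, hM, hbound⟩ := h.hbound K₁ hK₁A hK₁c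
  set ρ := min r (min ρb ρs) with hρ
  have hρ0 : 0 < ρ := by positivity
  have hρr : ρ ≤ r := min_le_left _ _
  have hρb' : ρ ≤ ρb := (min_le_right _ _).trans (min_le_left _ _)
  have hρs' : ρ ≤ ρs := (min_le_right _ _).trans (min_le_right _ _)
  refine ⟨ρ / 2, by positivity, M, hM, ?_⟩
  have h3 : ∀ᶠ δ in 𝓝[>] (0 : ℝ), 0 < δ := self_mem_nhdsWithin
  filter_upwards [h.adj, h.cuts, h.prim, h.pos, hbulk, hsgn, hbound, h3] with δ hadj hcuts hprim hN hb hs hbd hδ0 x hx q hq hsize y hy j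
  set c : Site 2 := ![x 0 - 2 * (4 * (2 * q) : ℕ), x 1 - 2 * (4 * (2 * q) : ℕ)] with hcdef
  have hcx : boxCentre c (4 * (2 * q)) = x := boxCentre_sub x (4 * (2 * q))
  have hxK₁ : meshPoint δ x ∈ K₁ := self_subset_cthickening K hx
  have hR : δ * (2 * ((2 * (2 * (4 * (2 * q))) + 3 : ℕ) : ℤ)) ≤ ρ := by
    push_cast
    nlinarith [hsize, hδ0.le]
  have hKb := kcBulkGauge_of_clauses (𝓕 := 𝓕) (Ω := Ω) (σ := σ) hδ0.le (x := x) (R := ((2 * (2 * (4 * (2 * q))) + 3 : ℕ) : ℤ)) hR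
    (fun y hy => hb x y hxK₁ (hy.trans hρb')) (fun y hy => hs x y hxK₁ (hy.trans hρs'))
  rw [← hcx] at hKb
  have hMN : 0 < M * N δ := mul_pos hM hN
  have hMw : ∀ y ∈ latticeBall (boxCentre c (4 * (2 * q))) (2 * (2 * (4 * (2 * q))) + 1), |𝓕.Hw δ y| ≤ M * N δ := by
    intro y hy
    rw [hcx] at hy
    have hd : dist (meshPoint δ y) (meshPoint δ x) ≤ ρ := by
      refine (KCFamily.dist_meshPoint_le_of_mem_latticeBall hδ0.le hy).trans (le_trans ?_ hR)
      gcongr; push_cast; linarith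
    exact (hbd y (Metric.mem_cthickening_of_dist_le _ _ _ _ hx (hd.trans hρr))).1
  have hMb : ∀ y ∈ latticeBall (boxCentre c (4 * (2 * q))) (2 * (2 * (4 * (2 * q))) + 1), |𝓕.Hb δ y| ≤ M * N δ := by
    intro y hy
    rw [hcx] at hy
    have hd : dist (meshPoint δ y) (meshPoint δ x) ≤ ρ := by
      refine (KCFamily.dist_meshPoint_le_of_mem_latticeBall hδ0.le hy).trans (le_trans ?_ hR)
      gcongr; push_cast; linarith
    exact (hbd y (Metric.mem_cthickening_of_dist_le _ _ _ _ hx (hd.trans hρr))).2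
  have hyb : y ∈ latticeBall (boxCentre c (4 * (2 * q))) q := by rw [hcx]; exact hy
  have hKb' : KCBulkGauge (discreteDomainGraph Ω δ) (𝓕.Λ δ) (𝓕.B δ) (𝓕.cut δ) (𝓕.P δ) (σ δ)
      (latticeBall (boxCentre c (4 * (2 * q))) (2 * (2 * (4 * (2 * q))) + 3)) := by
    convert hKb using 2
    push_cast; ring
  have key := norm_sub_rowGauge_kcObs_le_of_gauge hprim hcuts hadj (discreteDomainGraph_le_zdGraph Ω δ) (hg.pm δ) hq hKb' hMN
    hMw hMb hyb (Or.inl rfl) j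
  have hsq : 0 < Real.sqrt (N δ) := Real.sqrt_pos.2 hN
  rw [kcSupConst_mul M hN.le] at key
  have hgob : ∀ e, 𝓕.gobsN Ω N σ δ e = (((Real.sqrt (N δ))⁻¹ : ℝ) : ℂ) * rowGauge (σ δ) (𝓕.obs Ω δ) e := fun e => rfl
  rw [hgob, hgob, ← mul_sub, norm_mul, Complex.norm_real, Real.norm_eq_abs, abs_of_pos (inv_pos.2 hsq)]
  have h2q0 : (0 : ℝ) < ((2 * q : ℕ) : ℝ) := by positivity
  have hsq2 : 0 < Real.sqrt ((2 * q : ℕ) : ℝ) := Real.sqrt_pos.2 h2q0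
  calc (Real.sqrt (N δ))⁻¹ * ‖rowGauge (σ δ) (𝓕.obs Ω δ) (cSrc (y + cornerUnit j, 0)) - rowGauge (σ δ) (𝓕.obs Ω δ) (cSrc (y, 0))‖
      ≤ (Real.sqrt (N δ))⁻¹ * (8 * topGradConst * (Real.sqrt (N δ) * kcSupConst M / Real.sqrt (2 * q : ℕ)) / (2 * q : ℕ)) :=
        mul_le_mul_of_nonneg_left key (inv_nonneg.2 hsq.le)
    _ = 8 * topGradConst * kcSupConst M / ((2 * q : ℕ) * Real.sqrt (2 * q : ℕ)) := by
        field_simp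

/-- **s-holomorphicity of the gauged normalised section near a compact of a chart**: eventually in
the mesh, at every corner of every site within lattice sup-distance `2` of a site with mesh point in
`K`. [cite: ChelkakHonglerIzyurovAnnals2015, Prop. 2.4] -/
theorem IsNiceCore.isSHolAt_near (h : 𝓕.IsNiceCore Ω A N) (hg : 𝓕.IsGauge U σ) (hUA : U ⊆ Ω \ A)
    {K : Set ℂ} (hK : IsCompact K) (hKU : K ⊆ U) :
    ∀ᶠ δ in 𝓝[>] (0 : ℝ), ∀ x : Site 2, meshPoint δ x ∈ K → ∀ y ∈ latticeBall x 2, ∀ k : Fin 4,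
      IsSHolAt (𝓕.gobsN Ω N σ δ) (y, k) := by
  obtain ⟨ρb, hρb, hbulk⟩ := h.bulk K (hKU.trans hUA) hK
  obtain ⟨ρs, hρs, hsgn⟩ := hg.sgn K hKU hK
  set ρ := min ρb ρs with hρ
  have hρ0 : 0 < ρ := by positivity
  have hsmall : ∀ᶠ δ in 𝓝[>] (0 : ℝ), δ < ρ / 8 := nhdsWithin_le_nhds (Iio_mem_nhds (by positivity))
  have h3 : ∀ᶠ δ in 𝓝[>] (0 : ℝ), 0 < δ := self_mem_nhdsWithin
  filter_upwards [h.adj, h.cuts, hbulk, hsgn, hsmall, h3] with δ hadj hcuts hb hs hδs hδ0 x hx y hy k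
  have hR : δ * (2 * (3 : ℤ)) ≤ ρ := by push_cast; linarith
  have hKb := kcBulkGauge_of_clauses (𝓕 := 𝓕) (Ω := Ω) (σ := σ) hδ0.le (x := x) (R := 3) hR
    (fun y hy => hb x y hx (hy.trans (min_le_left _ _))) (fun y hy => hs x y hx (hy.trans (min_le_right _ _)))
  have hy3 : ∀ z ∈ latticeBall y 1, z ∈ latticeBall x 3 := by
    intro z hz; rw [mem_latticeBall] at hy hz ⊢; intro i; have := hy i; have := hz i; constructor <;> linarith
  have hy0 : y ∈ latticeBall y 0 := by rw [mem_latticeBall]; intro i; constructor <;> linarith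
  have key := hKb.isSHolAt (η := 1) (hg.pm δ) hcuts hadj (discreteDomainGraph_le_zdGraph Ω δ) (hy3 y (latticeBall_subset (by norm_num) hy0))
    (hy3 _ (add_cornerUnit_mem_latticeBall hy0 2)) (hy3 _ (add_cornerUnit_mem_latticeBall hy0 3)) k
  exact isSHolAt_const_mul _ key

/-- **The lattice cross hypothesis for the gauged normalised section on a chart.** [cite: Smirnov2010, proof of Lemma 3.6] -/
theorem IsNiceCore.latticeCrossHyp (h : 𝓕.IsNiceCore Ω A N) (hg : 𝓕.IsGauge U σ) (hUA : U ⊆ Ω \ A)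
    {K : Set ℂ} (hK : IsCompact K) (hKU : K ⊆ U) :
    LatticeCrossHyp (𝓕.gobsN Ω N σ) K := by
  filter_upwards [h.isSHolAt_near hg hUA hK hKU] with δ hS x hx
  have hx0 : x ∈ latticeBall x 0 := by rw [mem_latticeBall]; intro i; constructor <;> linarith
  have s0 := hS x hx x (latticeBall_subset (by norm_num) hx0) 0
  have s2 := hS x hx (x + cornerUnit 1) (latticeBall_subset (by norm_num) (add_cornerUnit_mem_latticeBall hx0 1)) 2
  have key := norm_sub_le_of_isSHolAt s0 s2
  have e2 : cSrc (x + cornerUnit 1, (2 : Fin 4)) = cSrc (x + cornerUnit 1 + cornerUnit 2, 0) := by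
    rw [cSrc_two, show (2 : Fin 4) = 0 + 2 from rfl, cornerUnit_add_two, sub_eq_add_neg]
  rwa [e2] at key

/-- **Cauchy–Riemann at the sites and faces near a compact of a chart.** [cite: Smirnov2010, Remark 3.3] -/
theorem IsNiceCore.cr (h : 𝓕.IsNiceCore Ω A N) (hg : 𝓕.IsGauge U σ) (hUA : U ⊆ Ω \ A)
    {K : Set ℂ} (hK : IsCompact K) (hKU : K ⊆ U) :
    ∀ᶠ δ in 𝓝[>] (0 : ℝ), ∀ x : Site 2, meshPoint δ x ∈ K → CRVertex (𝓕.gobsN Ω N σ δ) x ∧ CRFace (𝓕.gobsN Ω N σ δ) x := by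
  filter_upwards [h.isSHolAt_near hg hUA hK hKU] with δ hS x hx
  have hx0 : x ∈ latticeBall x 0 := by rw [mem_latticeBall]; intro i; constructor <;> linarith
  refine ⟨crVertex_of_isSHolAt fun k => hS x hx x (latticeBall_subset (by norm_num) hx0) k,
    crFace_of_isSHolAt fun j => hS x hx _ ?_ j⟩
  have := add_cornerOff_mem_latticeBall hx0 j
  exact latticeBall_subset (by norm_num) this

/-- **`|F_δ| ≤ M √δ` for the normalised section on compacts of a chart.** [cite: ChelkakHonglerIzyurovAnnals2015, Thm 3.12 (3.12)] -/
theorem IsNiceCore.exists_sqrt_bound (h : 𝓕.IsNiceCore Ω A N) (hg : 𝓕.IsGauge U σ) (hUo : IsOpen U) (hUA : U ⊆ Ω \ A)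
    {K : Set ℂ} (hK : IsCompact K) (hKU : K ⊆ U) :
    ∃ M : ℝ, 0 ≤ M ∧ ∀ᶠ δ in 𝓝[>] (0 : ℝ), ∀ x : Site 2, meshPoint δ x ∈ K → ∀ i : Fin 4, (i = 0 ∨ i = 1) →
      ‖𝓕.obsN Ω N δ (cSrc (x, i))‖ ≤ M * Real.sqrt δ := by
  obtain ⟨ρ, hρ, M, hM, hsup⟩ := h.latticeSupHyp hg hUo hUA hK hKU
  exact exists_sqrt_bound_of_latticeSupHyp hρ (kcSupConst_nonneg M) hsup

/-- The same bound for the gauged normalised section (equal norms). [cite: ChelkakHonglerIzyurovAnnals2015, Thm 3.12 (3.12)] -/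
theorem IsNiceCore.exists_sqrt_bound_gauged (h : 𝓕.IsNiceCore Ω A N) (hg : 𝓕.IsGauge U σ) (hUo : IsOpen U) (hUA : U ⊆ Ω \ A)
    {K : Set ℂ} (hK : IsCompact K) (hKU : K ⊆ U) :
    ∃ M : ℝ, 0 ≤ M ∧ ∀ᶠ δ in 𝓝[>] (0 : ℝ), ∀ x : Site 2, meshPoint δ x ∈ K → ∀ i : Fin 4, (i = 0 ∨ i = 1) →
      ‖𝓕.gobsN Ω N σ δ (cSrc (x, i))‖ ≤ M * Real.sqrt δ := by
  obtain ⟨M, hM0, hM⟩ := h.exists_sqrt_bound hg hUo hUA hK hKU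
  exact ⟨M, hM0, hM.mono fun δ hδ x hx i hi => by rw [norm_gobsN hg.pm]; exact hδ x hx i hi⟩

/-- **`√δ`-equicontinuity of the gauged normalised section on compacts of a chart.** [cite: ChelkakHonglerIzyurovAnnals2015, Thm 3.12 (3.13)] -/
theorem IsNiceCore.exists_equicont_bound (h : 𝓕.IsNiceCore Ω A N) (hg : 𝓕.IsGauge U σ) (hUo : IsOpen U) (hUA : U ⊆ Ω \ A)
    {K : Set ℂ} (hK : IsCompact K) (hKU : K ⊆ U) :
    ∃ L : ℝ, 0 ≤ L ∧ ∀ᶠ δ in 𝓝[>] (0 : ℝ), ∀ x x' : Site 2, meshPoint δ x ∈ K → meshPoint δ x' ∈ K →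
      ‖𝓕.gobsN Ω N σ δ (cSrc (x', 0)) - 𝓕.gobsN Ω N σ δ (cSrc (x, 0))‖ ≤
        L * Real.sqrt δ * (dist (meshPoint δ x') (meshPoint δ x) + δ) := by
  obtain ⟨M, hM0, hM⟩ := h.exists_sqrt_bound_gauged hg hUo hUA hK hKU
  obtain ⟨ρ, hρ, M', hM', hlip⟩ := h.latticeLipHyp hg hUo hUA hK hKU
  have hC' : 0 ≤ 8 * topGradConst * kcSupConst M' := by
    have := topGradConst_pos; have := kcSupConst_nonneg M'; positivity
  exact exists_equicont_bound_of_hyps hρ hC' hM0 hlip hM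

/-- **`|F_δ(vertical) - F_δ(horizontal)| = O(δ√δ)` for the gauged normalised section on compacts of a
chart.** [cite: Smirnov2010, §5] -/
theorem IsNiceCore.exists_cross_bound (h : 𝓕.IsNiceCore Ω A N) (hg : 𝓕.IsGauge U σ) (hUo : IsOpen U) (hUA : U ⊆ Ω \ A)
    {K : Set ℂ} (hK : IsCompact K) (hKU : K ⊆ U) :
    ∃ L : ℝ, 0 ≤ L ∧ ∀ᶠ δ in 𝓝[>] (0 : ℝ), ∀ x : Site 2, meshPoint δ x ∈ K →
      ‖𝓕.gobsN Ω N σ δ (cSrc (x, 1)) - 𝓕.gobsN Ω N σ δ (cSrc (x, 0))‖ ≤ L * δ * Real.sqrt δ := by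
  obtain ⟨ρ, hρ, M', hM', hlip⟩ := h.latticeLipHyp hg hUo hUA hK hKU
  have hC' : 0 ≤ 8 * topGradConst * kcSupConst M' := by
    have := topGradConst_pos; have := kcSupConst_nonneg M'; positivity
  exact exists_cross_bound_of_hyps hρ hC' (h.latticeCrossHyp hg hUA hK hKU) hlip

/-- **Precompactness of the gauged normalised section on a chart**: every sequence of meshes
`δ_n → 0⁺` has a subsequence along which `δ^{-1/2} gobsN` converges uniformly on compacts of `U` to
a function continuous there. [cite: ChelkakHonglerIzyurovAnnals2015, §3.4–3.5 (diagonal process)] -/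
theorem IsNiceCore.exists_subseq_limit (h : 𝓕.IsNiceCore Ω A N) (hg : 𝓕.IsGauge U σ) (hUo : IsOpen U) (hUA : U ⊆ Ω \ A)
    {s : ℕ → ℝ} (hs : Tendsto s atTop (𝓝[>] (0 : ℝ))) :
    ∃ φ : ℕ → ℕ, StrictMono φ ∧ ∃ g : ℂ → ℂ, ContinuousOn g U ∧
      ∀ K ⊆ U, IsCompact K → TendstoUniformlyOn (fun k z => scaledEdgeFamily (𝓕.gobsN Ω N σ) s (φ k) z) g atTop K :=
  exists_subseq_limit_of_bounds hUo
    (fun K hKU hK => by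
      obtain ⟨M, hM0, hM⟩ := h.exists_sqrt_bound_gauged hg hUo hUA hK hKU
      exact ⟨M, hM0, hM.mono fun δ hδ x hx => hδ x hx 0 (Or.inl rfl)⟩)
    (fun K hKU hK => h.exists_equicont_bound hg hUo hUA hK hKU) hs

/-- **Subsequential limits of the gauged normalised section are holomorphic on the chart.** [cite: ChelkakHonglerIzyurovAnnals2015, §3.4 ("f̃ is a holomorphic spinor")] -/
theorem IsNiceCore.differentiableOn_of_limit (h : 𝓕.IsNiceCore Ω A N) (hg : 𝓕.IsGauge U σ) (hUo : IsOpen U) (hUA : U ⊆ Ω \ A)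
    {s : ℕ → ℝ} (hs : Tendsto s atTop (𝓝[>] (0 : ℝ))) {g : ℂ → ℂ} (hgc : ContinuousOn g U)
    (hconv : ∀ K ⊆ U, IsCompact K → TendstoUniformlyOn (scaledEdgeFamily (𝓕.gobsN Ω N σ) s) g atTop K) :
    DifferentiableOn ℂ g U :=
  differentiableOn_of_limit_of_hyps hUo (fun K hKU hK => h.cr hg hUA hK hKU)
    (fun K hKU hK => by
      obtain ⟨L, -, hL⟩ := h.exists_cross_bound hg hUo hUA hK hKU
      exact ⟨L, hL⟩) hs hgc hconv

/-! ### The normalised primitive along a chart -/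

/-- **The increment formula for the normalised primitive near a compact off `A`**, eventually in the
mesh, in terms of the gauged normalised section of ANY row gauge with values `±1` (squares are
gauge-free). [cite: Smirnov2010, Remark 3.7; ChelkakHonglerIzyurovAnnals2015, Prop. 3.6] -/
theorem IsNiceCore.hwN_increment_near (h : 𝓕.IsNiceCore Ω A N) (hσ : ∀ δ r, σ δ r = 1 ∨ σ δ r = -1)
    {K : Set ℂ} (hK : IsCompact K) (hKA : K ⊆ Ω \ A) :
    ∀ᶠ δ in 𝓝[>] (0 : ℝ), ∀ y : Site 2, meshPoint δ y ∈ K → ∀ e : Fin 4,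
      𝓕.HwN N δ (y + cornerUnit e) - 𝓕.HwN N δ y =
        -(1 / (Real.sqrt 2 * kcFluxConst)) * (I ^ (e : ℕ) * ((1 : ℂ) * 𝓕.gobsN Ω N σ δ (cSrc (y, e))) ^ 2).im := by
  obtain ⟨ρ, hρ, hbulk⟩ := h.bulk K hKA hK
  have hsmall : ∀ᶠ δ in 𝓝[>] (0 : ℝ), δ < ρ / 8 := nhdsWithin_le_nhds (Iio_mem_nhds (by positivity))
  have h3 : ∀ᶠ δ in 𝓝[>] (0 : ℝ), 0 < δ := self_mem_nhdsWithin
  filter_upwards [h.adj, h.cuts, h.prim, h.pos, hbulk, hsmall, h3] with δ hadj hcuts hprim hN hb hδs hδ0 y hy e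
  have hnear : ∀ y' ∈ latticeBall y 3, dist (meshPoint δ y') (meshPoint δ y) ≤ ρ := by
    intro y' hy'
    have := KCFamily.dist_meshPoint_le_of_mem_latticeBall hδ0.le hy'
    push_cast at this; linarith
  have hy0 : y ∈ latticeBall y 0 := by rw [mem_latticeBall]; intro i; constructor <;> linarith
  have m1 : y + cornerUnit e ∈ latticeBall y 3 := latticeBall_subset (by norm_num) (add_cornerUnit_mem_latticeBall hy0 e)
  have m2 : y + cornerUnit e + cornerUnit 2 ∈ latticeBall y 3 :=
    latticeBall_subset (by norm_num) (add_cornerUnit_mem_latticeBall (add_cornerUnit_mem_latticeBall hy0 e) 2)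
  have m3 : y + cornerUnit e + cornerUnit 3 ∈ latticeBall y 3 :=
    latticeBall_subset (by norm_num) (add_cornerUnit_mem_latticeBall (add_cornerUnit_mem_latticeBall hy0 e) 3)
  have hyb := hb y y hy (hnear y (latticeBall_subset (by norm_num) hy0))
  have raw : 𝓕.Hw δ (y + cornerUnit e) - 𝓕.Hw δ y =
      -(1 / (Real.sqrt 2 * kcFluxConst)) * (I ^ (e : ℕ) * ((1 : ℂ) * 𝓕.obs Ω δ (cSrc (y, e))) ^ 2).im :=
    hprim.hw_increment_kcObs hcuts hadj (discreteDomainGraph_le_zdGraph Ω δ) e (hyb.2.2.2.1 e) (hb y _ hy (hnear _ m1)).1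
      (hb y _ hy (hnear _ m2)).1 (hb y _ hy (hnear _ m3)).1 (hb y _ hy (hnear _ m1)).2.2.2.1
  -- divide by `N δ` and re-express the square through the gauged normalised section
  have hsq : ((1 : ℂ) * 𝓕.gobsN Ω N σ δ (cSrc (y, e))) ^ 2 = (((N δ)⁻¹ : ℝ) : ℂ) * ((1 : ℂ) * 𝓕.obs Ω δ (cSrc (y, e))) ^ 2 := by
    rw [one_mul, one_mul, gobsN_sq hσ, obsN_sq hN]
  rw [hsq, HwN, HwN, ← sub_div, raw]
  have him : (I ^ (e : ℕ) * ((((N δ)⁻¹ : ℝ) : ℂ) * ((1 : ℂ) * 𝓕.obs Ω δ (cSrc (y, e))) ^ 2)).im =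
      (N δ)⁻¹ * (I ^ (e : ℕ) * ((1 : ℂ) * 𝓕.obs Ω δ (cSrc (y, e))) ^ 2).im := by
    rw [← mul_assoc, mul_comm (I ^ (e : ℕ)), mul_assoc, Complex.im_ofReal_mul]
  rw [him, div_eq_mul_inv]
  ring

/-- **Increments of `Hw/N` converge to `-κ Im ∫ g²`** along a sequence of meshes on which the gauged
normalised section of a chart converges: for a rectangle with ordered corners whose
`r`-neighbourhood `K` lies in the chart, and `δ_k^{-1/2} gobsN_{δ_k} → g` uniformly on `K`. [cite: ChelkakHonglerIzyurovAnnals2015, §3.4 (H_δ → Re∫f̃²)] -/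
theorem IsNiceCore.tendsto_hwN_staircase (h : 𝓕.IsNiceCore Ω A N) (hg : 𝓕.IsGauge U σ) (hUo : IsOpen U) (hUA : U ⊆ Ω \ A)
    {s : ℕ → ℝ} (hs : Tendsto s atTop (𝓝[>] (0 : ℝ)))
    {g : ℂ → ℂ} {z w : ℂ} (hre : z.re ≤ w.re) (him : z.im ≤ w.im)
    {K : Set ℂ} (hK : IsCompact K) (hKU : K ⊆ U) (hgc : ContinuousOn g K) {r : ℝ} (hr : 0 < r)
    (hKR : cthickening r (Rectangle z w) ⊆ K)
    (hconv : TendstoUniformlyOn (scaledEdgeFamily (𝓕.gobsN Ω N σ) s) g atTop K) :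
    Tendsto (fun k => 𝓕.HwN N (s k) (vtx (nearestSite (s k) z) (⌊(w.re - z.re) / s k⌋₊) (⌊(w.im - z.im) / s k⌋₊)) -
        𝓕.HwN N (s k) (nearestSite (s k) z)) atTop
      (𝓝 (-(1 / (Real.sqrt 2 * kcFluxConst)) * ((1 : ℂ) ^ 2 * ((∫ x : ℝ in z.re..w.re, g (x + z.im * I) ^ 2) +
          I * ∫ y : ℝ in z.im..w.im, g (w.re + y * I) ^ 2)).im)) := by
  have hKA : K ⊆ Ω \ A := hKU.trans hUA
  obtain ⟨L, -, hcross⟩ := h.exists_cross_bound hg hUo hUA hK hKU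
  obtain ⟨M, -, hM⟩ := h.exists_sqrt_bound_gauged hg hUo hUA hK hKU
  have hincr := h.hwN_increment_near hg.pm hK hKA
  have hsmall : ∀ᶠ δ in 𝓝[>] (0 : ℝ), δ < r / 3 := nhdsWithin_le_nhds (Iio_mem_nhds (by positivity))
  have hall := hs.eventually (((hcross.and hM).and hincr).and (hsmall.and (self_mem_nhdsWithin : ∀ᶠ δ in 𝓝[>] (0 : ℝ), 0 < δ)))
  obtain ⟨k₀, hk₀⟩ := eventually_atTop.1 hall
  set s' : ℕ → ℝ := fun k => s (k + k₀) with hs'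
  have hk : ∀ k, (((∀ x : Site 2, meshPoint (s' k) x ∈ K →
        ‖𝓕.gobsN Ω N σ (s' k) (cSrc (x, 1)) - 𝓕.gobsN Ω N σ (s' k) (cSrc (x, 0))‖ ≤ L * s' k * Real.sqrt (s' k)) ∧
      (∀ x : Site 2, meshPoint (s' k) x ∈ K → ∀ i : Fin 4, (i = 0 ∨ i = 1) →
        ‖𝓕.gobsN Ω N σ (s' k) (cSrc (x, i))‖ ≤ M * Real.sqrt (s' k))) ∧
      (∀ y : Site 2, meshPoint (s' k) y ∈ K → ∀ e : Fin 4, 𝓕.HwN N (s' k) (y + cornerUnit e) - 𝓕.HwN N (s' k) y =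
        -(1 / (Real.sqrt 2 * kcFluxConst)) * (I ^ (e : ℕ) * ((1 : ℂ) * 𝓕.gobsN Ω N σ (s' k) (cSrc (y, e))) ^ 2).im)) ∧
      (s' k < r / 3 ∧ 0 < s' k) := fun k => hk₀ (k + k₀) (Nat.le_add_left _ _)
  have hs'0 : ∀ k, 0 < s' k := fun k => (hk k).2.2
  have hs'lim : Tendsto s' atTop (𝓝 0) := (hs.mono_right nhdsWithin_le_nhds).comp (tendsto_add_atTop_nat k₀)
  have hconv' : TendstoUniformlyOn (scaledEdgeFamily (𝓕.gobsN Ω N σ) s') g atTop K := tendstoUniformlyOn_shift hconv k₀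
  have core := tendsto_staircase_of_increments (Fm := 𝓕.gobsN Ω N σ) hs'0 hs'lim hre him hK hgc hr hKR hconv'
    (fun k => by have := (hk k).2.1; linarith) (fun k x hx => (hk k).1.1.1 x hx) (fun k x hx i hi => (hk k).1.1.2 x hx i hi)
    (fun k => 𝓕.HwN N (s' k)) (κ := 1 / (Real.sqrt 2 * kcFluxConst)) (θ₀ := 1) (fun k y hy e => (hk k).1.2 y hy e)
  rw [hs'] at core
  exact (tendsto_add_atTop_iff_nat (f := fun k => 𝓕.HwN N (s k) (vtx (nearestSite (s k) z) (⌊(w.re - z.re) / s k⌋₊)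
    (⌊(w.im - z.im) / s k⌋₊)) - 𝓕.HwN N (s k) (nearestSite (s k) z)) k₀).1 core

end KCSectionFamily

end Literature.Probability.LatticeModels
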